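import Summits.QuantumFields.YangMills.Theorems.BalabanUVNodesN07Thm4RecordStructureSym152PhiE
import HarnessLib
/-!
# N07 [B11] (= [15] = [Balaban1985Variational]) Sect. F — **(c-ii)‴ `HThm4RecSym152PhiEG`: THE GUARD EDITION OF THE φ-b₂ PREMISE OF RECORD** — ✓p748560's (c-ii)″ `HThm4RecSym152PhiE`
# VERBATIM except that the datum carries ONE more displayed row, the K0 grid guard's divisibility letters at a DENT MODULUS `Md`:
# `∀ i, 1 ≤ i → i ≤ k → Md ∣ M·R_i ∧ Lⁱ·M·R_i ∣ sitesPerDir 0` (`R_i = RkOfRecord L r g_i` of (2.5), `M` = [I]'s basic cube size) — EXACTLY the consequent of the K0 chain's displayed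
# guard implication `hAdm₂` (77c⁗E ∕ 90E ∕ 99″ ∕ 100⁵ ∕ 119, with `Md := L·Mh`), so the door below discharges it from the step guard and NO new hypothesis enters the K0 chain; door; mono

Cell `pub-ymgap`, seat `pub-ymgap-dag-n07-e` g32 (FAN-OUT §N07 row s3; LANE OWNER of the K0 road chart side).  `--kind definition --supports stmt-QuantumFields-20541 --as helper` (K0⁷);
count-neutral.  ONE `def` (displayed premise, NEVER asserted) + bookkeeping theorems.  [15] = [Balaban1985Variational]; [6] = [Balaban1985RegularSpaces]; [3] = [Balaban1985Averaging];
[I] = [Balaban1987RG1]; [III] = [Balaban1988Convergent].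

WHY (dag-n07-w3 g13 ⚑ LOCATED-TOP-DENT, Q2′ pub-ymgap bus 2026-08-29 22:30Z; n07-e g32 ANSWER 2026-08-30 00:2xZ).  The junction's φ-adapter `DatumCrownPhiAt` (p751640) reads row 9′ at the
print datum DENTED at the top by the run's region `Ω_j` ([15] (150) «Ω′_k = □_k ∩ Ω_k»), and n05-e's record crown engine needs the dent to be saturated for `L^{s+1}·Lʲ`-superblocks anchored
at `Lʲ·(cornerP − ρ) − c_j` — which holds iff `L^{s+1} ∣ M·R_j` (the `𝐃_j` cubes of record have side `dCubeSide L M R_j j = Lʲ·M·R_j`, [III] (2.1)) together with the torus period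
`Lʲ·M·R_j ∣ sitesPerDir 0`.  In print `M = L^m` ([I] §1 p. 257 «cubes of a size M, where M = L^m»; [III] p. 245) and `R_j` is «the smallest number of the form L^r such that …» ([III] (2.5)
p. 255), on the torus `L_μ = L^m` ([I] (0.1) p. 251), so both hold there (pub-ymgap RR-2 WORD-30 page word 2026-08-30); in the tree `M` is a bare input of
`SeqOfRecord`, and it is the REGISTERED K0 guard `A‴(c, c₀, c₁)` of V22-Z stub 1 (conjuncts `F.L ^ c₁ ∣ M` and `∀ i ≤ k, dCubeSide … ∣ sitesPerDir 0`) that restores them — the def of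
record (β) binds `M` bare and cannot see them.  THIS EDITION displays them at the datum, at a free modulus `Md` (the K0 door instantiates `Md := L·Mh = L^{a′+1}`, the junction
`Md := L^{s+1}`; monotone under `Md ∣ Md′`).

WHAT IS DECLARED ∕ PROVED (sorry-free; axioms standard).  §2 `HThm4RecSym152PhiEG F N Mc ρ Md κ a₀ Ψ`; `hThm4RecSym152PhiEG_of_phiE` ((c-ii)″ ⇒ (c-ii)‴ at every `Md` — the premise is
WEAKER); `hThm4RecSym152PhiEG_mono` (κ up, a₀ down, Ψ up pointwise, `Md ∣ Md′`).  §3 ★★★ `hS3NORMSym152PhiE_of_hThm4RecSym152PhiEG` — THE DOOR to 77c⁵'s HS3NORM-152 clause (OUTPUT byte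
for byte that of ✓p748560's door; INPUT `hAdm₂` verbatim + the G text at its modulus).  §4 A6: the ∃-clause is unchanged, so ✓p748560's
`hThm4RecSym152PhiE_conclusion_at_one` is the certificate (cited, not restated).
HONEST LABEL (binding).  `HThm4RecSym152PhiEG` is a CONDITIONAL premise (N05's (B′) road + the φ-junction; licence: variant, our proof); this file DISCHARGES NOTHING of it; (β) = (c-ii)″
stays the def OF RECORD until the custodian's word; K0⁷ ∕ K1⁹ NOT closed; N07 ∕ N05 NOT discharged; counts unmoved; one finite 𝕋⁴ programme at fixed ε — the route closes the conditional
finite-𝕋⁴ rung `BalabanLadder.UV` ONLY; the YM mass gap (Clay) is NOT proved by any of this; nothing continuum ∕ ℝ⁴ ∕ OS.  ONE `def`, no `instance`, no `notation`, no `sorry`.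

References: [6] Thm. 4 p. 88, Prop. 6 (1.130)–(1.138) p. 99, (1.29) p. 81; [15] (144) p. 300, (147)–(153) p. 301; [3] (78)–(81) p. 30; [I] (0.1) p. 251, §1 p. 257, (0.4)–(0.11)
pp. 253–254; [III] p. 245, (2.1) p. 254, (2.5) p. 255.
-/

set_option autoImplicit false

noncomputable section
open scoped BigOperators Matrix.Norms.L2Operator

namespace Summit.QuantumFields.YangMills.BalabanUVNodes.N07Thm4RecordStructureSym152PhiEG

open Literature.MathematicalPhysics.QuantumFieldTheory.Balaban1983to89
open Literature.MathematicalPhysics.QuantumFieldTheory.Balaban1983to89.Node00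
open Literature.MathematicalPhysics.QuantumFieldTheory.Balaban1983to89.B15DeterminingSets
open Literature.MathematicalPhysics.QuantumFieldTheory.Balaban1983to89.B12RegularSpaces111 (gaugeU expI grad)
open B15Eq112TorusCover (cover)
open B14DomainGeom (Pt Within)
open B8Eq131Cubes (sqLo sqHi box cube)
open B5Eq118OneStroke (iterBlockOf)
open B6SectADomainsV1 (Domains)
open B6SectAOperatorsV1 (BondIdx RE dsE QpE)
open Literature.MathematicalPhysics.QuantumFieldTheory.BalabanImbrieJaffe1984to88.BIJ85AxialPropagator411 (BondSpace)
open T4Continuum (T4Family)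
open Summit.QuantumFields.YangMills.BalabanUVNodes.N07Thm4RecordStructureSym152Phi (NrmSymPhiOfRecord nrmSymPhiOfRecord_one)
open Summit.QuantumFields.YangMills.BalabanUVNodes.N07Thm4RecordStructureSym152PhiE (HThm4RecSym152PhiE hThm4RecSym152PhiE_conclusion_at_one)
open Summit.QuantumFields.YangMills.BalabanUVNodes.N07DatumGauge152Guarded (two_mul_pow_le_sitesPerDir_of_levelGuard)
open GaugeField (gaugeAct)
open B8Eq131Cubes (tLo tHi ctr)

variable (F : T4Family) (N : ℕ) [NeZero N]

/-! ## §2  The named premise, (152)-complete on the tower, row 9′ up to `Ψ ε j`, AT DATA CARRYING THE GRID GUARD's DIVISIBILITY LETTERS (modulus `Md`) -/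


/-- **`HThm4RecSym152PhiEG` — THE GUARD EDITION OF `HThm4RecSym152PhiE` (dent modulus `Md`)**: [6] Theorem 4 ∕ Proposition 6 with [15] (152)–(153) (first AND second member of (152) on the whole
tower), at every meeting datum of a separated run WHOSE STEP DATA SATISFY THE GRID LETTERS `Md ∣ M·R_i` and `Lⁱ·M·R_i ∣ sitesPerDir 0` (`1 ≤ i ≤ k`; print: `M = L^m` [I] §1 p. 257, `R_i` a power of `L` [III] p. 245 ∕ (2.5) p. 255, torus side `L_μ = L^m`
[I] (0.1) p. 251 — pub-ymgap RR-2 WORD-30 page word) — ✓p748560's rows 1–8 + (T2b) + row 9′ := `NrmSymPhiOfRecord … (Ψ ε j) … u A` VERBATIM.  A displayed premise, NEVER asserted (print-licensed [I] pp. 253–254 for the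
(0.4)∕(0.11) structure; (B′) road = variant, our proof); WEAKER than (c-ii)″ (one more hypothesis on the data). [cite: Balaban1985RegularSpaces, Thm. 4 p.88, Prop. 6 (1.130)–(1.138) p.99, (1.29) p.81; Balaban1985Variational, (147)–(153) p.301, (150) p.301; Balaban1985Averaging, (78)–(81) p.30; Balaban1987RG1, p.257, (0.1) p.251, (0.4)–(0.9) pp.253–254; Balaban1988Convergent, p.245, (2.5) p.255, (2.1) p.254] -/
def HThm4RecSym152PhiEG (Mc ρ Md : ℕ) (κ a₀ : ℝ) (Ψ : (ℕ → ℝ) → ℕ → ℝ) : Prop :=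
  0 < κ → ∀ (ν : Stage7Numerics) (M : ℕ) (g : ℕ → ℝ) (K k : ℕ) (s : SeqOfRecord F ν M g K k), Sect2.SeqSeparated ν.M₁ s → 0 < ν.M₁ →
    (11 * 4 + 4 * ρ + Mc + 3) * F.L ≤ ν.M₁ → Mc + 11 * 4 + 6 * ρ ≤ (F.P K).sitesPerDir k → 1 ≤ k →
    -- ★ THE GRID GUARD's DIVISIBILITY LETTERS at modulus `Md` (the consequent of the K0 chain's `hAdm₂` with `Md := L·Mh`; the junction reads `Md := L^{s+1}`)
    (∀ i : ℕ, 1 ≤ i → i ≤ k →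
      Md ∣ M * RkOfRecord (F.P K).L ν.r (g i) ∧ dCubeSide (F.P K).L M (RkOfRecord (F.P K).L ν.r (g i)) i ∣ (F.P K).sitesPerDir 0) →
    ∀ (ε : ℕ → ℝ), (∀ n, n ≤ k → 0 < ε n ∧ ε n ≤ a₀) → (∀ n, n < k → ε n ≤ 2 * ε (n + 1)) →
    ∀ U : GaugeField (F.P K) 0 (SU N),
    (∀ n, n ≤ k → PlaqSmallOn (Sect2.omegaPlaqsTop s.Ω (suppDomOfRecord F ν K s.Ω) n) (ε n * (F.P K).eta n ^ 2) U) →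
    (∀ n, n ≤ k → Sect2.CoDivSmallOn (Sect2.omegaBondsTop s.Ω (suppDomOfRecord F ν K s.Ω) n) (ε n * (F.P K).eta n ^ 3) U) →
    ∀ (j : ℕ) (hk : j ≤ (F.P K).m + (F.P K).K), 1 ≤ j → j ≤ k → ∀ (idx : Pt (F.P K).d),
    (∃ x ∈ box (F.P K).L (cornerP (F.P K) Mc ρ idx) (sideP (F.P K) Mc ρ) j, ∃ y : Pt (F.P K).d, cover (F.P K) y ∈ s.Ω j ∧ Within ((3 : ℕ) : ℤ) x y) →
    ∃ (u : GaugeTransf (F.P K) 0 (SU N)) (A : PBond (F.P K) 0 → MatA N),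
      (∀ b ∈ (Sect2.regionOfSet (F.P K) (cover (F.P K) '' box (F.P K).L (cornerP (F.P K) Mc ρ idx) (sideP (F.P K) Mc ρ) j)).bonds,
        gaugeU (fun x => ιSU N (u x)) (fun b' => ιSU N (U b')) b = expI ((F.P K).eta j) (A b)) ∧
      (∀ b ∈ (Sect2.regionOfSet (F.P K) (cover (F.P K) '' cube (F.P K).L (cornerP (F.P K) Mc ρ idx) (sideP (F.P K) Mc ρ) ρ j 0)).bonds,
        gaugeU (fun x => ιSU N (u x)) (fun b' => ιSU N (U b')) b = expI ((F.P K).eta j) (A b)) ∧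
      (∀ j', j' ≤ j →
        ∀ b ∈ (Sect2.regionOfSet (F.P K) (cover (F.P K) '' cube (F.P K).L (cornerP (F.P K) Mc ρ idx) (sideP (F.P K) Mc ρ) ρ j j')).bonds,
          ‖A b‖ < κ * ε j * ((F.P K).L : ℝ) ^ (j - j')) ∧
      -- ★ (T2b): print's (152) SECOND member on the tower
      (∀ j', j' ≤ j →
        ∀ q ∈ (Sect2.regionOfSet (F.P K) (cover (F.P K) '' cube (F.P K).L (cornerP (F.P K) Mc ρ idx) (sideP (F.P K) Mc ρ) ρ j j')).dpairs,
          ‖grad ((F.P K).eta j) q.2.1 (fun y => A ⟨y, q.2.2⟩) q.1‖ < κ * ε j * ((F.P K).L : ℝ) ^ (2 * (j - j'))) ∧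
      (∀ b ∈ (Sect2.regionOfSet (F.P K) (cover (F.P K) '' box (F.P K).L (cornerP (F.P K) Mc ρ idx) (sideP (F.P K) Mc ρ) j)).bonds,
        ‖A b‖ < κ * ε j) ∧
      (∀ q ∈ (Sect2.regionOfSet (F.P K) (cover (F.P K) '' box (F.P K).L (cornerP (F.P K) Mc ρ idx) (sideP (F.P K) Mc ρ) j)).dpairs,
        ‖grad ((F.P K).eta j) q.2.1 (fun y => A ⟨y, q.2.2⟩) q.1‖ < κ * ε j) ∧
      (∀ b ∈ Sect2.bondsDeep (cover (F.P K) '' box (F.P K).L (cornerP (F.P K) Mc ρ idx) (sideP (F.P K) Mc ρ) j),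
        ‖Sect2.codiffCurlA ((F.P K).eta j) A b.src b.dir‖ < κ * ε j) ∧
      (∀ b ∈ Sect2.bondsDeep (cover (F.P K) '' box (F.P K).L (cornerP (F.P K) Mc ρ idx) (sideP (F.P K) Mc ρ) j),
        ‖∑ ν' : Fin (F.P K).d, (((F.P K).eta j : ℝ) : ℂ)⁻¹ •
            (grad ((F.P K).eta j) ν' (fun y => A ⟨y, b.dir⟩) (b.src.unshift ν') - grad ((F.P K).eta j) ν' (fun y => A ⟨y, b.dir⟩) b.src)‖ < κ * ε j) ∧
      (∀ φ : MatA N →L[ℂ] ℂ,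
        RE (domainsMeet (cubeDomains (F.P K) (cornerP (F.P K) Mc ρ idx) (sideP (F.P K) Mc ρ) ρ j hk) (domainsOfSeq s.Ω j hk)) ((F.P K).eta j)⁻¹
            (dsE ((F.P K).eta j)⁻¹ (WithLp.toLp 2 fun b => (φ (A b)).re : BondSpace (F.P K))) = 0 ∧
        RE (domainsMeet (cubeDomains (F.P K) (cornerP (F.P K) Mc ρ idx) (sideP (F.P K) Mc ρ) ρ j hk) (domainsOfSeq s.Ω j hk)) ((F.P K).eta j)⁻¹
            (dsE ((F.P K).eta j)⁻¹ (WithLp.toLp 2 fun b => (φ (A b)).im : BondSpace (F.P K))) = 0) ∧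
      NrmSymPhiOfRecord F N Mc ρ (Ψ ε j) ν M g K k s U j idx u A

variable {F N}

/-- **PROJECTION (c-ii)″ ⇒ (c-ii)‴**: the def of record implies the guard edition at EVERY modulus `Md` (the new datum row is simply not used). [cite: Balaban1985Variational, (152) p.301 (bookkeeping); Balaban1988Convergent, (2.5) p.255] -/
theorem hThm4RecSym152PhiEG_of_phiE {Mc ρ : ℕ} (Md : ℕ) {κ a₀ : ℝ} {Ψ : (ℕ → ℝ) → ℕ → ℝ} (h : HThm4RecSym152PhiE F N Mc ρ κ a₀ Ψ) :
    HThm4RecSym152PhiEG F N Mc ρ Md κ a₀ Ψ :=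
  fun h0 ν M g K k s hsep hM₁ hfl hnw hk _ ε hε hcomp U h17 h19 j hk' hj1 hjk idx hmeet =>
    h h0 ν M g K k s hsep hM₁ hfl hnw hk ε hε hcomp U h17 h19 j hk' hj1 hjk idx hmeet

/-- **MONOTONICITY**: for `0 < κ ≤ κ′`, `a₀′ ≤ a₀`, `Ψ ≤ Ψ′` pointwise and `Md ∣ Md′`: `HThm4RecSym152PhiEG F N Mc ρ Md κ a₀ Ψ → HThm4RecSym152PhiEG F N Mc ρ Md′ κ′ a₀′ Ψ′` (a datum whose
`M·R_i` the larger modulus divides is a datum for the smaller one). [cite: Balaban1985RegularSpaces, Prop. 6 p.99; Balaban1985Variational, (152) p.301; Balaban1988Convergent, (2.5) p.255 (bookkeeping)] -/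
theorem hThm4RecSym152PhiEG_mono {Mc ρ Md Md' : ℕ} {κ κ' a₀ a₀' : ℝ} {Ψ Ψ' : (ℕ → ℝ) → ℕ → ℝ} (h0 : 0 < κ) (hκ : κ ≤ κ') (ha : a₀' ≤ a₀) (hΨ : ∀ ε j, Ψ ε j ≤ Ψ' ε j)
    (hMd : Md ∣ Md') (h : HThm4RecSym152PhiEG F N Mc ρ Md κ a₀ Ψ) : HThm4RecSym152PhiEG F N Mc ρ Md' κ' a₀' Ψ' := by
  intro _ ν M g K k s hsep hM₁ hfl hnw hk hgrid ε hε hcomp U h17 h19 j hk' hj1 hjk idx hmeet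
  have hε' : ∀ n, n ≤ k → 0 < ε n ∧ ε n ≤ a₀ := fun n hn => ⟨(hε n hn).1, (hε n hn).2.trans ha⟩
  have hgrid' : ∀ i : ℕ, 1 ≤ i → i ≤ k →
      Md ∣ M * RkOfRecord (F.P K).L ν.r (g i) ∧ dCubeSide (F.P K).L M (RkOfRecord (F.P K).L ν.r (g i)) i ∣ (F.P K).sitesPerDir 0 :=
    fun i hi hik => ⟨hMd.trans (hgrid i hi hik).1, (hgrid i hi hik).2⟩
  obtain ⟨u, A, h1, hT1, hT2, hT2b, h2, h3, h4, h5, h6, hN⟩ :=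
    h h0 ν M g K k s hsep hM₁ hfl hnw hk hgrid' ε hε' hcomp U h17 h19 j hk' hj1 hjk idx hmeet
  have hεj : 0 ≤ ε j := (hε j hjk).1.le
  have hκε : κ * ε j ≤ κ' * ε j := mul_le_mul_of_nonneg_right hκ hεj
  refine ⟨u, A, h1, hT1, ?_, ?_, ?_, ?_, ?_, ?_, h6, hN.mono (hΨ ε j)⟩
  · intro j' hj' b hb
    exact (hT2 j' hj' b hb).trans_le (mul_le_mul_of_nonneg_right hκε (pow_nonneg (Nat.cast_nonneg _) _))
  · intro j' hj' q hq
    exact (hT2b j' hj' q hq).trans_le (mul_le_mul_of_nonneg_right hκε (pow_nonneg (Nat.cast_nonneg _) _))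
  · intro b hb; exact (h2 b hb).trans_le hκε
  · intro q hq; exact (h3 q hq).trans_le hκε
  · intro b hb; exact (h4 b hb).trans_le hκε
  · intro b hb; exact (h5 b hb).trans_le hκε

/-! ## §3  The door: 77c⁵'s (152)-complete HS3NORM clause at `Nrm := fun … s ε U j idx u A ↦ NrmSymPhiOfRecord … (Ψ ε j) …` -/

variable (F N)

/-- ★★★ **THE CONDITIONAL DOOR S1ᶜ, (152)-COMPLETE, GUARD EDITION**: from `HThm4RecSym152PhiEG F N Mc ρ Md κ a₀ Ψ` and the knit's TWO guard implications — `hAdm₁ : Adm … → c ≤ ν.M₁ ∧ k + c₀ ≤ F.m + K`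
and the grid implication `hAdm₂ : Adm … → ∀ i, 1 ≤ i → i ≤ k → Md ∣ M·R_i ∧ Lⁱ·M·R_i ∣ sitesPerDir 0` (displayed VERBATIM by the K0 chain 77c⁗E ∕ 90E ∕ 99″ ∕ 100⁵ ∕ 119 with `Md := L·Mh`) — with
the side conditions `(11·4 + 4ρ + Mc + 3)·L ≤ c`, `Mc + 11·4 + 6ρ ≤ 2·L^{c₀}`, `0 < B₃`, `0 < κ`: the HS3NORM-152 clause of the ε-indexed knit at `Nrm := NrmSymPhiOfRecord F N Mc ρ (Ψ ε j)`.
OUTPUT byte for byte that of ✓p748560's door `hS3NORMSym152PhiE_of_hThm4RecSym152PhiE`; the new datum row is discharged from the step guard by `hAdm₂`. [cite: Balaban1985Variational, (144) p.300, (147)–(153) p.301; Balaban1985RegularSpaces, Prop. 6 p.99, Thm. 4 p.88, (1.29) p.81; Balaban1987RG1, (0.1) p.251, p.257, (0.4) p.253; Balaban1988Convergent, (2.5) p.255] -/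
theorem hS3NORMSym152PhiE_of_hThm4RecSym152PhiEG {ρ Mc Md : ℕ} {c c₀ : ℕ} (hc : (11 * 4 + 4 * ρ + Mc + 3) * F.L ≤ c) (hc₀ : Mc + 11 * 4 + 6 * ρ ≤ 2 * F.L ^ c₀)
    (Adm : StepGuard F) (hAdm₁ : ∀ (ν : Stage7Numerics) (M : ℕ) (g : ℕ → ℝ) (K k : ℕ) (s : SeqOfRecord F ν M g K k), Adm ν M g K k s → c ≤ ν.M₁ ∧ k + c₀ ≤ F.m + K)
    (hAdm₂ : ∀ (ν : Stage7Numerics) (M : ℕ) (g : ℕ → ℝ) (K k : ℕ) (s : SeqOfRecord F ν M g K k), Adm ν M g K k s → ∀ i : ℕ, 1 ≤ i → i ≤ k →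
      Md ∣ M * RkOfRecord (F.P K).L ν.r (g i) ∧ dCubeSide (F.P K).L M (RkOfRecord (F.P K).L ν.r (g i)) i ∣ (F.P K).sitesPerDir 0)
    {B₃ κ a₀ a₁ : ℝ} (hB₃ : 0 < B₃) (hκ : 0 < κ) {Ψ : (ℕ → ℝ) → ℕ → ℝ} (hT : HThm4RecSym152PhiEG F N Mc ρ Md κ a₀ Ψ) :
    ∀ (ν : Stage7Numerics) (M : ℕ) (g : ℕ → ℝ) (K k : ℕ) (s : SeqOfRecord F ν M g K k), Sect2.SeqSeparated ν.M₁ s → 0 < ν.M₁ →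
      Adm ν M g K k s → 1 ≤ k →
      ∀ (ε δ : ℕ → ℝ),
      (∀ n, n ≤ k → 0 < δ n ∧ δ n ≤ a₁) → (∀ n, n < k → δ n ≤ 2 * δ (n + 1)) → (∀ n, n < k → δ (n + 1) ≤ 2 * δ n) →
      (∀ n, n ≤ k → B₃ * δ n ≤ ε n ∧ ε n ≤ a₀) → (∀ n, n < k → ε n ≤ 2 * ε (n + 1)) → (∀ n, n < k → ε (n + 1) ≤ 2 * ε n) →
      ∀ W : MSField (F.P K) (SU N), Sect2.DataSmall7PTop (avOfRecord F N K) s.Ω (suppDomOfRecord F ν K s.Ω) k δ W →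
      ∀ U : GaugeField (F.P K) 0 (SU N),
      (∀ n, n ≤ k → PlaqSmallOn (Sect2.omegaPlaqsTop s.Ω (suppDomOfRecord F ν K s.Ω) n) (ε n * (F.P K).eta n ^ 2) U) →
      (∀ n, n ≤ k → Sect2.CoDivSmallOn (Sect2.omegaBondsTop s.Ω (suppDomOfRecord F ν K s.Ω) n) (ε n * (F.P K).eta n ^ 3) U) →
      AgreeOn (genSet s.Ω k) (avgFamily (avOfRecord F N K) U) W → IsCritOnFibre F N K (genSet s.Ω k) W U →
      ∀ (n : ℕ) (hk : K - n ≤ (F.P K).m + (F.P K).K), 1 ≤ K - n → K - n ≤ k → ∀ (idx : Pt (F.P K).d),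
      (∃ x ∈ box (F.P K).L (cornerP (F.P K) Mc ρ idx) (sideP (F.P K) Mc ρ) (K - n), ∃ y : Pt (F.P K).d, cover (F.P K) y ∈ s.Ω (K - n) ∧ Within ((3 : ℕ) : ℤ) x y) →
      (K - n = k ∨ ∀ z ∈ box (F.P K).L (cornerP (F.P K) Mc ρ idx - ((2 * ρ : ℕ) : Pt (F.P K).d)) (sideP (F.P K) Mc ρ + 2 * (2 * ρ)) (K - n),
        cover (F.P K) z ∉ s.Ω (K - n + 1)) →
      ∃ (u : GaugeTransf (F.P K) 0 (SU N)) (A : PBond (F.P K) 0 → MatA N),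
      (∀ b ∈ (Sect2.regionOfSet (F.P K) (cover (F.P K) '' box (F.P K).L (cornerP (F.P K) Mc ρ idx) (sideP (F.P K) Mc ρ) (K - n))).bonds,
        gaugeU (fun x => ιSU N (u x)) (fun b' => ιSU N (U b')) b = expI ((F.P K).eta (K - n)) (A b)) ∧
      (∀ b ∈ (Sect2.regionOfSet (F.P K) (cover (F.P K) '' cube (F.P K).L (cornerP (F.P K) Mc ρ idx) (sideP (F.P K) Mc ρ) ρ (K - n) 0)).bonds,
        gaugeU (fun x => ιSU N (u x)) (fun b' => ιSU N (U b')) b = expI ((F.P K).eta (K - n)) (A b)) ∧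
      (∀ j', j' ≤ K - n →
        ∀ b ∈ (Sect2.regionOfSet (F.P K) (cover (F.P K) '' cube (F.P K).L (cornerP (F.P K) Mc ρ idx) (sideP (F.P K) Mc ρ) ρ (K - n) j')).bonds,
          ‖A b‖ < κ * ε (K - n) * ((F.P K).L : ℝ) ^ (K - n - j')) ∧
      (∀ j', j' ≤ K - n →
        ∀ q ∈ (Sect2.regionOfSet (F.P K) (cover (F.P K) '' cube (F.P K).L (cornerP (F.P K) Mc ρ idx) (sideP (F.P K) Mc ρ) ρ (K - n) j')).dpairs,
          ‖grad ((F.P K).eta (K - n)) q.2.1 (fun y => A ⟨y, q.2.2⟩) q.1‖ < κ * ε (K - n) * ((F.P K).L : ℝ) ^ (2 * (K - n - j'))) ∧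
      (∀ b ∈ (Sect2.regionOfSet (F.P K) (cover (F.P K) '' box (F.P K).L (cornerP (F.P K) Mc ρ idx) (sideP (F.P K) Mc ρ) (K - n))).bonds,
        ‖A b‖ < κ * ε (K - n)) ∧
      (∀ q ∈ (Sect2.regionOfSet (F.P K) (cover (F.P K) '' box (F.P K).L (cornerP (F.P K) Mc ρ idx) (sideP (F.P K) Mc ρ) (K - n))).dpairs,
        ‖grad ((F.P K).eta (K - n)) q.2.1 (fun y => A ⟨y, q.2.2⟩) q.1‖ < κ * ε (K - n)) ∧
      (∀ b ∈ Sect2.bondsDeep (cover (F.P K) '' box (F.P K).L (cornerP (F.P K) Mc ρ idx) (sideP (F.P K) Mc ρ) (K - n)),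
        ‖Sect2.codiffCurlA ((F.P K).eta (K - n)) A b.src b.dir‖ < κ * ε (K - n)) ∧
      (∀ b ∈ Sect2.bondsDeep (cover (F.P K) '' box (F.P K).L (cornerP (F.P K) Mc ρ idx) (sideP (F.P K) Mc ρ) (K - n)),
        ‖∑ ν' : Fin (F.P K).d, (((F.P K).eta (K - n) : ℝ) : ℂ)⁻¹ •
            (grad ((F.P K).eta (K - n)) ν' (fun y => A ⟨y, b.dir⟩) (b.src.unshift ν') - grad ((F.P K).eta (K - n)) ν' (fun y => A ⟨y, b.dir⟩) b.src)‖ <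
          κ * ε (K - n)) ∧
      (∀ D' : Domains (F.P K), LinearMap.ker (QpE D') ≤
          LinearMap.ker (QpE (domainsMeet (cubeDomains (F.P K) (cornerP (F.P K) Mc ρ idx) (sideP (F.P K) Mc ρ) ρ (K - n) hk) (domainsOfSeq s.Ω (K - n) hk))) →
        ∀ φ : MatA N →L[ℂ] ℂ,
        RE D' ((F.P K).eta (K - n))⁻¹ (dsE ((F.P K).eta (K - n))⁻¹ (WithLp.toLp 2 fun b => (φ (A b)).re : BondSpace (F.P K))) = 0 ∧
        RE D' ((F.P K).eta (K - n))⁻¹ (dsE ((F.P K).eta (K - n))⁻¹ (WithLp.toLp 2 fun b => (φ (A b)).im : BondSpace (F.P K))) = 0) ∧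
      NrmSymPhiOfRecord F N Mc ρ (Ψ ε (K - n)) ν M g K k s U (K - n) idx u A := by
  intro ν M g K k s hsep hM₁ hadm hk1 ε δ hδ _ _ hεr hcomp _ W _ U h17 h19 _ _ n hk hn1 hnk idx hdat _
  obtain ⟨hcν, hlevF⟩ := hAdm₁ ν M g K k s hadm
  have hfl : (11 * 4 + 4 * ρ + Mc + 3) * F.L ≤ ν.M₁ := hc.trans hcν
  have hlevP : k + c₀ ≤ (F.P K).m + (F.P K).K := by rw [T4Family.P_m, T4Family.P_K]; exact hlevF
  have hlev : Mc + 11 * 4 + 6 * ρ ≤ (F.P K).sitesPerDir k := by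
    refine hc₀.trans ?_
    have := two_mul_pow_le_sitesPerDir_of_levelGuard (P := F.P K) le_rfl hlevP
    rwa [T4Family.P_L] at this
  have hε : ∀ m, m ≤ k → 0 < ε m ∧ ε m ≤ a₀ := fun m hm =>
    ⟨lt_of_lt_of_le (mul_pos hB₃ (hδ m hm).1) (hεr m hm).1, (hεr m hm).2⟩
  obtain ⟨u, A, h1, hT1, hT2, hT2b, h2, h3, h4, h5, h6, hN⟩ :=
    hT hκ ν M g K k s hsep hM₁ hfl hlev hk1 (hAdm₂ ν M g K k s hadm) ε hε hcomp U h17 h19 (K - n) hk hn1 hnk idx hdat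
  exact ⟨u, A, h1, hT1, hT2, hT2b, h2, h3, h4, h5, fun D' hD' φ => ⟨RE_eq_zero_of_ker_le hD' (h6 φ).1, RE_eq_zero_of_ker_le hD' (h6 φ).2⟩, hN⟩

/-! ## §4  A6: the ∃-clause of `HThm4RecSym152PhiEG` is (c-ii)″'s byte for byte, so ✓p748560's `hThm4RecSym152PhiE_conclusion_at_one` IS its certificate at the trivial field
(no restatement — the gate's dedup rule). -/

end Summit.QuantumFields.YangMills.BalabanUVNodes.N07Thm4RecordStructureSym152PhiEG

end
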